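import Summits.BirchSwinnertonDyer.BirchSwinnertonDyer.Theorems.RamifiedHeegnerPairLeafUpperMembersOfReadingOptimalOffRows
import HarnessLib

/-!
# Route `RamifiedHeegnerPair` (rev 11) — the generated glue G₁ `LeafRankOneUpperAtThreeGlue` (item 27494) of the U₁ split
# holds MODULO the route's rank-zero lower member L₀ (item 26023): G₁ hides nothing beyond L₀
# (lead prover bsd-line-rhp-p2 g6; `--supports stmt-BirchSwinnertonDyer-27494`, helper; BSD is not proved by any of this)

The pen's W-81′ split of U₁ (`LeafRankOneUpperAtThree`, 26022; route rev 11) files the children of the registered skeleton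
`splitkolyvagin` v5 as items 27491 PUB⁺ (`LeafRankOnePrintedInputsAtThree`), 27492 S2 (`JetchevDivisibilityReadingS2`), 27493 Σ★″
(`LeafSigmaStarDivisibilityAtThreeOptimalOffRows`) and the generated glue 27494 `LeafRankOneUpperAtThreeGlue := PUB⁺ → S2 → Σ★″ → U₁`.
The skeleton's fourth stub, L₀ = item 26023 `Gss2LowerAtThreeRankZero` BY NAME, could not be a child of U₁ (it is a member declared
after U₁'s family in the route file), so G₁ is L₀-CONDITIONAL by design. This file records the kernel fact behind that design:
`Gss2LowerAtThreeRankZero → LeafRankOneUpperAtThreeGlue`, by the skeleton's composition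
(`sigmaOptOffRows_of_sigmaStarOptOffRows`, p622097, then
`leafRankOneUpperAtThree_of_pubManin_of_divisibilityReading_of_sigmaOptOffRows_of_lowerRankZero`, p621612). It does NOT close 27494
(L₀ is open); it shows that once 27491 ∧ 27492 ∧ 27493 ∧ 26023 are proved, U₁ follows. Nothing is asserted; no item is closed.
[cite: Jetchev2008, Conj. 1.3 and Thm. 1.4 (p. 812)] [cite: MatarNekovar2019, Thm. 0.7 (p. 456)] [cite: Miller2011LMS, Def. 1.1]
-/

-- D-0017: single-problem summit, so `Summit.BirchSwinnertonDyer.BirchSwinnertonDyer.…` repeats a namespace BY DESIGN.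
set_option linter.dupNamespace false
set_option autoImplicit false

noncomputable section

namespace Summit.BirchSwinnertonDyer.BirchSwinnertonDyer.Theorems.RamifiedPairUpperBound

open Summit.BirchSwinnertonDyer.BirchSwinnertonDyer.Theses.RamifiedHeegnerPair

/-- **G₁ modulo L₀**: the generated glue `LeafRankOneUpperAtThreeGlue` (PUB⁺ → S2 → Σ★″ → U₁, item 27494) from the route's
rank-zero lower member `Gss2LowerAtThreeRankZero` (item 26023), by the registered composition of skeleton `splitkolyvagin` v5:
weaken Σ★″ to the rank-one orientation Σ″ and run the Manin-free optimal-member road. CONDITIONAL on L₀ (hypothesis); closes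
nothing. [cite: Jetchev2008, Conj. 1.3 (p. 812)] [cite: MatarNekovar2019, Thm. 0.7 (p. 456)] [cite: Miller2011LMS, Def. 1.1] -/
theorem leafRankOneUpperAtThreeGlue_of_lowerRankZero (hL0 : Gss2LowerAtThreeRankZero) : LeafRankOneUpperAtThreeGlue :=
  fun hP hS hSig ↦
    leafRankOneUpperAtThree_of_pubManin_of_divisibilityReading_of_sigmaOptOffRows_of_lowerRankZero hP hS
      (sigmaOptOffRows_of_sigmaStarOptOffRows hSig) hL0

end Summit.BirchSwinnertonDyer.BirchSwinnertonDyer.Theorems.RamifiedPairUpperBound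

end
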